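import Summits.SmoothPoincare4.SmoothPoincare4.Theorems.ConvexBisectionAcyclicBisectionExistsHurwitzMoveContract
import Summits.SmoothPoincare4.SmoothPoincare4.Theorems.ConvexBisectionAcyclicBisectionExistsPageTwistingTransverseLoop
import HarnessLib

/-!
# N1 ▸ `node_N1_move` ▸ (c₁) THE FREE SLICE MOVE: the CONTRACT, CORRECTED HYPOTHESIS LIST OF THE CORE
# `HC1 ⇐ (core′) ∧ (seam) ∧ (iso)`, and the page twisting of a rigidly rotated attaching map
(wave 8, brick of stub `stub_M2geo` = node N1 of NF4 ▸ `node_N1_move_of_pieces (HC1) (HC2) (HD) (HE)`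
(`…HurwitzMoveContract.lean`) ▸ `HC1`; line `modp-braid-orbits`, crux `ConvexBisection.AcyclicBisectionExists`,
item stmt-SmoothPoincare4-10508; worker J5, lead c5; design v3 `work/design/N1_SliceMove_Design.lean`;
registered sub-goal `helper_pageTwisting_transport_rigid`)

Sequel of `…SliceMoveContract.lean` (`piece_c1_of_subpieces (HCORE) (HSEAM) (HISO) : HC1`).  FINDING
(J5-F1, design v3 §0): the re-digging core CANNOT be stated over `(X, h, D)` alone — its conclusion (the new
base embedding `D'.jA` covers the old deep belt circle `B` of `k₀` by plain base points, fibredly) forces the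
boundary page function `θ_X` (`arg w` on seam points, `arg (d k)` on the `k`-th belt circle) to be SMOOTH
ACROSS `B`, which for a general Kosinski attaching map is false (it holds iff the `1`-jet of the tube along
the core is "Lefschetz": page twisting `±1` AND first-harmonic normal derivative); in the node it is
guaranteed exactly by the page-certifying boundary diffeomorphism `Ψ` with its seam and belt clauses
(`θ_X = arg w ∘ Ψ`).  So the hypothesis `HCORE` of the first contract, quantified over all `(X, h, D)`, is
not provable; this file lands the contract again with the core `HCORE'` carrying the FULL hypothesis list of
`HC1` (the fibred datum `(X₀, bX, Ψ, X, G₀, h, D)` with the seam and belt clauses) and the same Ψ-free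
CONCLUSION (new attaching maps `h'` and a new datum `D'` of the same `X`, `k₀`-th circle literally
`R ψ ∘ K`, other circles, framings and the page twisting of `k₀` unchanged, seam/belt dichotomy against
`(h, D)`).  With `Ψ` in hand the core has a concrete route (design v3 §1): the `Ψ`-conjugate
`σ_t = Ψ̃⁻¹ R_t Ψ̃` of the rigid rotation is a smooth flow on `∂X` raising `θ_X` by exactly `t`; the new
datum is `(D.transport M).mapDiffeo Γ̂` with `M` G4's sector rotation (`helper_rotFlow_sector`) and `Γ̂` a
collar extension (`BoundaryData.nonempty_collar_holds`) of `Γ z = σ_{a (w (β z))} z`, `a` the angular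
displacement of `M`, `β` the base coordinate of a seam point.

§1 `helper_pageTwisting_transport_rigid`: the page twisting of an attaching map whose circle lies in a
page is unchanged by transport along a stage `R ψ` of a rigid page rotation (time-rescale `R` to an
ambient isotopy with stage `1` equal to `R ψ` and apply `pageTwisting_transport_eq_of_fibred`, p132432's
file) — the twisting clause of `HCORE'` for the transported tube `(h k₀).transport (R.toDiffeomorph ψ)`.
§2 `piece_c1_of_subpieces'` — the assembly, as in the first contract (`X' := X`, `G := refl`, `R₁ := R`,
`τ₁ := ε`).  Everything here is proved; the pieces enter as hypotheses; no `sorry`.  References: R. E. Gompf,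
A. I. Stipsicz, *4-Manifolds and Kirby Calculus* (1999), §8.2 [GompfStipsicz1999]; J. B. Etnyre, T. Fuller,
IMRN 2006, §2 [EtnyreFuller2006].
-/

noncomputable section

set_option linter.dupNamespace false

open scoped Manifold ContDiff Topology Real
open Set Function

namespace Summit.SmoothPoincare4.SmoothPoincare4.Theorems.AcyclicBisectionExists.ModpBraidOrbits

open Literature.GroupTheory.CombinatorialGroupTheory.SignedHurwitz
open Literature.Topology.FourManifolds Literature.Topology.FourManifolds.LefschetzBase
open Literature.Topology.FourManifolds.HandleAttachingMap

/-! ## §1 The page twisting of a rigidly rotated attaching map -/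

/-- **Sub-goal `helper_pageTwisting_transport_rigid`** (fully qualified): if `R` is a rigid page rotation
of `Base g` (`w (R t x) = e^{it} w x`, flat part kept) and the attaching circle of `q` lies in `page g c`,
`‖c‖ = 1`, then the attaching map `q.transport (R ψ)` — circle `R ψ ∘ K`, handle framing `d(R ψ)(ν)` — has
the page twisting of `q`: the time-rescaled family `s ↦ R (s ψ)` is an ambient isotopy keeping the circle
in the pages of directions `c e^{isψ}`, so `pageTwisting_transport_eq_of_fibred` applies.
[cite: EtnyreFuller2006, §2] -/
theorem helper_pageTwisting_transport_rigid : ∀ (g : ℕ) (R : Literature.Topology.FourManifolds.AmbientIsotopy (𝓡∂ 4) (Literature.Topology.FourManifolds.LefschetzBase.Base g)), (∀ (t : ℝ) (x : Literature.Topology.FourManifolds.LefschetzBase.Base g), Literature.Topology.FourManifolds.LefschetzBase.w g (R.toFun t x).1 = Complex.exp ((t : ℂ) * Complex.I) * Literature.Topology.FourManifolds.LefschetzBase.w g x.1) → (∀ (t : ℝ) (x : Literature.Topology.FourManifolds.LefschetzBase.Base g), ‖Literature.Topology.FourManifolds.LefschetzBase.cx (R.toFun t x).1‖ ^ 2 <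 4 ↔ ‖Literature.Topology.FourManifolds.LefschetzBase.cx x.1‖ ^ 2 < 4) → ∀ (q : Literature.Topology.FourManifolds.HandleAttachingMap 3 2 (Literature.Topology.FourManifolds.LefschetzBase.Base g)) (c : ℂ) (ψ : ℝ), ‖c‖ = 1 → (∀ θ, q.attachingCircle θ ∈ Literature.Topology.FourManifolds.LefschetzBase.page g c) → Literature.Topology.FourManifolds.LefschetzBase.pageTwisting g (q.transport (R.toDiffeomorph ψ)).attachingCircle (q.transport (R.toDiffeomorph ψ)).attachingFraming = Literature.Topology.FourManifolds.LefschetzBase.pageTwisting g q.attachingCircle q.attachingFraming := by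
  intro g R hRw hRcx q c ψ hc hq
  -- the time-rescaled ambient isotopy `s ↦ R (s ψ)`
  let R' : AmbientIsotopy (𝓡∂ 4) (Base g) :=
    { toFun := fun s => R.toFun (s * ψ)
      contMDiff := R.contMDiff.comp
        (((contDiff_id.mul contDiff_const).contMDiff.comp contMDiff_fst).prodMk contMDiff_snd)
      bijective := fun s => R.bijective (s * ψ)
      isLocalDiffeomorph := fun s => R.isLocalDiffeomorph (s * ψ)
      map_zero := by
        show R.toFun (0 * ψ) = id
        rw [zero_mul, R.map_zero] }
  have hD : R.toDiffeomorph ψ = R'.toDiffeomorph 1 := Diffeomorph.ext fun x => by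
    show R.toFun ψ x = R.toFun (1 * ψ) x
    rw [one_mul]
  rw [hD]
  refine pageTwisting_transport_eq_of_fibred R' q
    (fun s => c * Complex.exp (((s * ψ : ℝ) : ℂ) * Complex.I)) (fun s _ => ?_) (fun s _ θ => ?_)
  · rw [norm_mul, hc, Complex.norm_exp_ofReal_mul_I, mul_one]
  · show R.toFun (s * ψ) (q.attachingCircle θ) ∈ page g (c * Complex.exp (((s * ψ : ℝ) : ℂ) * Complex.I))
    refine ⟨(hRcx _ _).2 (hq θ).1, ?_⟩
    rw [hRw, (hq θ).2]
    ring

/-! ## §2 The contract `HC1 ⇐ (core′) ∧ (seam) ∧ (iso)` with the corrected core -/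

set_option maxHeartbeats 800000 in
-- three ∀-texts of 40–45 binders each as hypotheses and a 21-component witness
/-- **Piece (c₁) `HC1` of `node_N1_move_of_pieces` from its three sub-pieces, corrected core** (design
v3): `HCORE'` = the re-digging over the FULL fibred datum (hypotheses of `HC1` verbatim; conclusion: new
attaching maps `h'` and a new multi-attachment datum `D'` of the same `X` with `k₀`-th circle `R ψ ∘ K`,
the other circles and framings and the page twisting of `k₀` unchanged, and the seam/belt dichotomy of
`(h', D')` against `(h, D)`), `HSEAM` = the seam bookkeeping (LANDED: `piece_c1_seam`,
`…SliceMoveSeam.lean`), `HISO` = the isotopy realisation `R₃ τ₃ ∘ L' = R ψ ∘ K`.  The conclusion is the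
text of `HC1` VERBATIM; witnesses `X' := X`, `G := refl`, `R₁ := R`, `τ₁ := ε`.
[cite: GompfStipsicz1999, §8.2] -/
theorem piece_c1_of_subpieces'
    (HCORE' : ∀ (g n : ℕ) (X₀ : Type) [TopologicalSpace X₀] [T2Space X₀] [SecondCountableTopology X₀] [CompactSpace X₀] [ChartedSpace (EuclideanHalfSpace 4) X₀] [IsManifold (𝓡∂ 4) ∞ X₀] (bX : BoundaryData (𝓡∂ 4) X₀ (𝓡 3)) (Ψ : bX.carrier ≃ₘ⟮𝓡 3, 𝓡 3⟯ (bBase g).carrier) (X : Type) [TopologicalSpace X] [T2Space X] [SecondCountableTopology X] [CompactSpace X] [ChartedSpace (EuclideanHalfSpace 4) X] [IsManifold (𝓡∂ 4) ∞ X] (G₀ : X₀ ≃ₘ⟮𝓡∂ 4, 𝓡∂ 4⟯ X) (h : Fin n → HandleAttachingMap 3 2 (Base g)) (D : MultiAttachmentData h (𝓡∂ 4) X) (d : Fin n → ℂ), (∀ k, ‖d k‖ = 1) → (∀ k θ, (h k).attachingCircle θ ∈ page g (d k)) → (∀ (y : bX.carrier) (a : ↥(coresComplement h)), G₀ (bX.incl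 y) = D.jA a → ∃ c : ℝ, 0 < c ∧ w g ((bBase g).incl (Ψ y)).1 = (c : ℂ) * w g (a : Base g).1) → (∀ (y : bX.carrier) (k : Fin n) (b : ↥(beltPiece 3 2)), G₀ (bX.incl y) = D.jB k b → G₀ (bX.incl y) ∉ range D.jA → ∃ c : ℝ, 0 < c ∧ w g ((bBase g).incl (Ψ y)).1 = (c : ℂ) * d k) → ∀ (k₀ : Fin n) (ψ : ℝ) (R : AmbientIsotopy (𝓡∂ 4) (Base g)), ψ ≠ 0 → |ψ| < 2 * π → (∀ (t : ℝ) (x : Base g), rho g (R.toFun t x).1 = rho g x.1) → (∀ (t : ℝ) (x : Base g), w g (R.toFun t x).1 = Complex.exp ((t : ℂ) * Complex.I) * w g x.1) → (∀ (t : ℝ) (x : Base g), ‖cx (R.toFun t x).1‖ ^ 2 < 4 ↔ ‖cx x.1‖ ^ 2 < 4) → (∀ (t t' : ℝ) (x : Base g), R.toFun t (R.toFun t' x) = R.toFun (t + t') x) → (∀ k, k ≠ k₀ → ∀ t ∈ Set.Icc (0 : ℝ) 1, d k ≠ d k₀ * Complex.exp (((t * ψ : ℝ) : ℂ) * Complex.I))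 → ∃ (h' : Fin n → HandleAttachingMap 3 2 (Base g)) (D' : MultiAttachmentData h' (𝓡∂ 4) X), (∀ θ, (h' k₀).attachingCircle θ = R.toFun ψ ((h k₀).attachingCircle θ)) ∧ (∀ k, k ≠ k₀ → (h' k).attachingCircle = (h k).attachingCircle ∧ (h' k).attachingFraming = (h k).attachingFraming) ∧ pageTwisting g (h' k₀).attachingCircle (h' k₀).attachingFraming = pageTwisting g (h k₀).attachingCircle (h k₀).attachingFraming ∧ (∀ a' : ↥(coresComplement h'), D'.jA a' ∈ (𝓡∂ 4).boundary X → (∃ a : ↥(coresComplement h), D'.jA a' = D.jA a ∧ ∃ c : ℝ, 0 < c ∧ w g (a' : Base g).1 = (c : ℂ) * w g (a : Base g).1) ∨ (∃ (k : Fin n) (b : ↥(beltPiece 3 2)), D'.jA a' = D.jB k b ∧ D'.jA a' ∉ range D.jA ∧ ∃ c : ℝ, 0 < c ∧ w g (a' : Base g).1 = (c : ℂ) * d k)) ∧ (∀ (k' : Fin n) (b' : ↥(beltPiece 3 2)), D'.jB k' b' ∉ range D'.jA → D'.jB k' b' ∈ (𝓡∂ 4).boundary X → (∃ a : ↥(coresComplement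 h), D'.jB k' b' = D.jA a ∧ ∃ c : ℝ, 0 < c ∧ w g (a : Base g).1 = (c : ℂ) * Function.update d k₀ (d k₀ * Complex.exp ((ψ : ℂ) * Complex.I)) k') ∨ (∃ (k : Fin n) (b : ↥(beltPiece 3 2)), D'.jB k' b' = D.jB k b ∧ D'.jB k' b' ∉ range D.jA ∧ d k = Function.update d k₀ (d k₀ * Complex.exp ((ψ : ℂ) * Complex.I)) k')))
    (HSEAM : ∀ (g n : ℕ) (X₀ : Type) [TopologicalSpace X₀] [T2Space X₀] [SecondCountableTopology X₀] [CompactSpace X₀] [ChartedSpace (EuclideanHalfSpace 4) X₀] [IsManifold (𝓡∂ 4) ∞ X₀] (bX : BoundaryData (𝓡∂ 4) X₀ (𝓡 3)) (Ψ : bX.carrier ≃ₘ⟮𝓡 3, 𝓡 3⟯ (bBase g).carrier) (X : Type) [TopologicalSpace X] [T2Space X] [SecondCountableTopology X] [CompactSpace X] [ChartedSpace (EuclideanHalfSpace 4) X] [IsManifold (𝓡∂ 4) ∞ X] (G₀ : X₀ ≃ₘ⟮𝓡∂ 4, 𝓡∂ 4⟯ X) (h : Fin n → HandleAttachingMap 3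 2 (Base g)) (D : MultiAttachmentData h (𝓡∂ 4) X) (d : Fin n → ℂ), (∀ k, ‖d k‖ = 1) → (∀ k θ, (h k).attachingCircle θ ∈ page g (d k)) → (∀ (y : bX.carrier) (a : ↥(coresComplement h)), G₀ (bX.incl y) = D.jA a → ∃ c : ℝ, 0 < c ∧ w g ((bBase g).incl (Ψ y)).1 = (c : ℂ) * w g (a : Base g).1) → (∀ (y : bX.carrier) (k : Fin n) (b : ↥(beltPiece 3 2)), G₀ (bX.incl y) = D.jB k b → G₀ (bX.incl y) ∉ range D.jA → ∃ c : ℝ, 0 < c ∧ w g ((bBase g).incl (Ψ y)).1 = (c : ℂ) * d k) → ∀ (k₀ : Fin n) (ψ : ℝ) (R : AmbientIsotopy (𝓡∂ 4) (Base g)), ψ ≠ 0 → |ψ| < 2 * π → (∀ (t : ℝ) (x : Base g), rho g (R.toFun t x).1 = rho g x.1) → (∀ (t : ℝ) (x : Base g), w g (R.toFun t x).1 = Complex.exp ((t : ℂ) * Complex.I) * w g x.1) → (∀ (t : ℝ) (x : Base g), ‖cx (R.toFun t x).1‖ ^ 2 < 4 ↔ ‖cx x.1‖ ^ 2 < 4)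 → (∀ (t t' : ℝ) (x : Base g), R.toFun t (R.toFun t' x) = R.toFun (t + t') x) → (∀ k, k ≠ k₀ → ∀ t ∈ Set.Icc (0 : ℝ) 1, d k ≠ d k₀ * Complex.exp (((t * ψ : ℝ) : ℂ) * Complex.I)) → ∃ (ε : ℝ) (L L' : Metric.sphere (0 : EuclideanSpace ℝ (Fin 2)) 1 → Base g) (y y' : Metric.sphere (0 : EuclideanSpace ℝ (Fin 2)) 1 → bX.carrier) (a a' : Metric.sphere (0 : EuclideanSpace ℝ (Fin 2)) 1 → ↥(coresComplement h)), (0 < ε / ψ ∧ ε / ψ < 1) ∧ Continuous L ∧ Continuous L' ∧ (∀ θ, L θ = R.toFun ε ((h k₀).attachingCircle θ)) ∧ (∀ θ, L θ ∈ page g (d k₀ * Complex.exp ((ε : ℂ) * Complex.I))) ∧ (∀ θ, G₀ (bX.incl (y θ)) = D.jA (a θ)) ∧ (∀ θ, ((a θ : ↥(coresComplement h)) : Base g) = L θ) ∧ (∀ θ, (bBase g).incl (Ψ (y' θ)) = R.toFun (ψ - ε) ((bBase g).incl (Ψ (y θ)))) ∧ (∀ θ, G₀ (bX.incl (y' θ))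 = D.jA (a' θ)) ∧ (∀ θ, ((a' θ : ↥(coresComplement h)) : Base g) = L' θ))
    (HISO : ∀ (g n : ℕ) (X₀ : Type) [TopologicalSpace X₀] [T2Space X₀] [SecondCountableTopology X₀] [CompactSpace X₀] [ChartedSpace (EuclideanHalfSpace 4) X₀] [IsManifold (𝓡∂ 4) ∞ X₀] (bX : BoundaryData (𝓡∂ 4) X₀ (𝓡 3)) (Ψ : bX.carrier ≃ₘ⟮𝓡 3, 𝓡 3⟯ (bBase g).carrier) (X : Type) [TopologicalSpace X] [T2Space X] [SecondCountableTopology X] [CompactSpace X] [ChartedSpace (EuclideanHalfSpace 4) X] [IsManifold (𝓡∂ 4) ∞ X] (G₀ : X₀ ≃ₘ⟮𝓡∂ 4, 𝓡∂ 4⟯ X) (h : Fin n → HandleAttachingMap 3 2 (Base g)) (D : MultiAttachmentData h (𝓡∂ 4) X) (d : Fin n → ℂ), (∀ k, ‖d k‖ = 1) → (∀ k θ, (h k).attachingCircle θ ∈ page g (d k)) → (∀ (y : bX.carrier) (a : ↥(coresComplement h)), G₀ (bX.incl y) = D.jA a → ∃ c : ℝ, 0 < c ∧ w g ((bBase g).incl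 (Ψ y)).1 = (c : ℂ) * w g (a : Base g).1) → (∀ (y : bX.carrier) (k : Fin n) (b : ↥(beltPiece 3 2)), G₀ (bX.incl y) = D.jB k b → G₀ (bX.incl y) ∉ range D.jA → ∃ c : ℝ, 0 < c ∧ w g ((bBase g).incl (Ψ y)).1 = (c : ℂ) * d k) → ∀ (k₀ : Fin n) (ψ : ℝ) (R : AmbientIsotopy (𝓡∂ 4) (Base g)), ψ ≠ 0 → |ψ| < 2 * π → (∀ (t : ℝ) (x : Base g), rho g (R.toFun t x).1 = rho g x.1) → (∀ (t : ℝ) (x : Base g), w g (R.toFun t x).1 = Complex.exp ((t : ℂ) * Complex.I) * w g x.1) → (∀ (t : ℝ) (x : Base g), ‖cx (R.toFun t x).1‖ ^ 2 < 4 ↔ ‖cx x.1‖ ^ 2 < 4) → (∀ (t t' : ℝ) (x : Base g), R.toFun t (R.toFun t' x) = R.toFun (t + t') x) → (∀ k, k ≠ k₀ → ∀ t ∈ Set.Icc (0 : ℝ) 1, d k ≠ d k₀ * Complex.exp (((t * ψ : ℝ) : ℂ) * Complex.I)) → ∀ (ε : ℝ) (L L' : Metric.sphere (0 : EuclideanSpace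 ℝ (Fin 2)) 1 → Base g) (y y' : Metric.sphere (0 : EuclideanSpace ℝ (Fin 2)) 1 → bX.carrier) (a a' : Metric.sphere (0 : EuclideanSpace ℝ (Fin 2)) 1 → ↥(coresComplement h)), (0 < ε / ψ ∧ ε / ψ < 1) → (∀ θ, L θ = R.toFun ε ((h k₀).attachingCircle θ)) → (∀ θ, G₀ (bX.incl (y θ)) = D.jA (a θ)) → (∀ θ, ((a θ : ↥(coresComplement h)) : Base g) = L θ) → (∀ θ, (bBase g).incl (Ψ (y' θ)) = R.toFun (ψ - ε) ((bBase g).incl (Ψ (y θ)))) → (∀ θ, G₀ (bX.incl (y' θ)) = D.jA (a' θ)) → (∀ θ, ((a' θ : ↥(coresComplement h)) : Base g) = L' θ) → ∃ (R₃ : AmbientIsotopy (𝓡∂ 4) (Base g)) (τ₃ : ℝ), ∀ θ, R₃.toFun τ₃ (L' θ) = R.toFun ψ ((h k₀).attachingCircle θ)) :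
    ∀ (g n : ℕ) (X₀ : Type) [TopologicalSpace X₀] [T2Space X₀] [SecondCountableTopology X₀] [CompactSpace X₀] [ChartedSpace (EuclideanHalfSpace 4) X₀] [IsManifold (𝓡∂ 4) ∞ X₀] (bX : BoundaryData (𝓡∂ 4) X₀ (𝓡 3)) (Ψ : bX.carrier ≃ₘ⟮𝓡 3, 𝓡 3⟯ (bBase g).carrier) (X : Type) [TopologicalSpace X] [T2Space X] [SecondCountableTopology X] [CompactSpace X] [ChartedSpace (EuclideanHalfSpace 4) X] [IsManifold (𝓡∂ 4) ∞ X] (G₀ : X₀ ≃ₘ⟮𝓡∂ 4, 𝓡∂ 4⟯ X) (h : Fin n → HandleAttachingMap 3 2 (Base g)) (D : MultiAttachmentData h (𝓡∂ 4) X) (d : Fin n → ℂ), (∀ k, ‖d k‖ = 1) → (∀ k θ, (h k).attachingCircle θ ∈ page g (d k)) → (∀ (y : bX.carrier) (a : ↥(coresComplement h)), G₀ (bX.incl y) = D.jA a → ∃ c : ℝ, 0 < c ∧ w g ((bBase g).incl (Ψ y)).1 = (c : ℂ) * w g (a : Base g).1) → (∀ (y : bX.carrier) (k : Fin n) (b :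 ↥(beltPiece 3 2)), G₀ (bX.incl y) = D.jB k b → G₀ (bX.incl y) ∉ range D.jA → ∃ c : ℝ, 0 < c ∧ w g ((bBase g).incl (Ψ y)).1 = (c : ℂ) * d k) → ∀ (k₀ : Fin n) (ψ : ℝ) (R : AmbientIsotopy (𝓡∂ 4) (Base g)), ψ ≠ 0 → |ψ| < 2 * π → (∀ (t : ℝ) (x : Base g), rho g (R.toFun t x).1 = rho g x.1) → (∀ (t : ℝ) (x : Base g), w g (R.toFun t x).1 = Complex.exp ((t : ℂ) * Complex.I) * w g x.1) → (∀ (t : ℝ) (x : Base g), ‖cx (R.toFun t x).1‖ ^ 2 < 4 ↔ ‖cx x.1‖ ^ 2 < 4) → (∀ (t t' : ℝ) (x : Base g), R.toFun t (R.toFun t' x) = R.toFun (t + t') x) → (∀ k, k ≠ k₀ → ∀ t ∈ Set.Icc (0 : ℝ) 1, d k ≠ d k₀ * Complex.exp (((t * ψ : ℝ) : ℂ) * Complex.I)) → ∃ (X' : Type) (_ : TopologicalSpace X') (_ : T2Space X') (_ : SecondCountableTopology X') (_ : CompactSpace X') (_ : ChartedSpace (EuclideanHalfSpace 4) X') (_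 : IsManifold (𝓡∂ 4) ∞ X') (h' : Fin n → HandleAttachingMap 3 2 (Base g)) (D' : MultiAttachmentData h' (𝓡∂ 4) X') (G : X ≃ₘ⟮𝓡∂ 4, 𝓡∂ 4⟯ X') (R₁ R₃ : AmbientIsotopy (𝓡∂ 4) (Base g)) (τ₁ τ₃ ε : ℝ) (L L' : Metric.sphere (0 : EuclideanSpace ℝ (Fin 2)) 1 → Base g) (y y' : Metric.sphere (0 : EuclideanSpace ℝ (Fin 2)) 1 → bX.carrier) (a a' : Metric.sphere (0 : EuclideanSpace ℝ (Fin 2)) 1 → ↥(coresComplement h)), (0 < ε / ψ ∧ ε / ψ < 1) ∧ Continuous L ∧ Continuous L' ∧ (∀ θ, L θ = R₁.toFun τ₁ ((h k₀).attachingCircle θ)) ∧ (∀ θ, L θ ∈ page g (d k₀ * Complex.exp ((ε : ℂ) * Complex.I))) ∧ (∀ θ, G₀ (bX.incl (y θ)) = D.jA (a θ)) ∧ (∀ θ, ((a θ : ↥(coresComplement h)) : Base g) = L θ) ∧ (∀ θ, (bBase g).incl (Ψ (y' θ)) = R.toFun (ψ - ε) ((bBase g).incl (Ψ (y θ)))) ∧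 (∀ θ, G₀ (bX.incl (y' θ)) = D.jA (a' θ)) ∧ (∀ θ, ((a' θ : ↥(coresComplement h)) : Base g) = L' θ) ∧ (∀ θ, (h' k₀).attachingCircle θ = R₃.toFun τ₃ (L' θ)) ∧ (∀ θ, (h' k₀).attachingCircle θ ∈ page g (d k₀ * Complex.exp ((ψ : ℂ) * Complex.I))) ∧ (∀ k, k ≠ k₀ → (h' k).attachingCircle = (h k).attachingCircle ∧ (h' k).attachingFraming = (h k).attachingFraming) ∧ pageTwisting g (h' k₀).attachingCircle (h' k₀).attachingFraming = pageTwisting g (h k₀).attachingCircle (h k₀).attachingFraming ∧ (∀ a' : ↥(coresComplement h'), G.symm (D'.jA a') ∈ (𝓡∂ 4).boundary X → (∃ a : ↥(coresComplement h), G.symm (D'.jA a') = D.jA a ∧ ∃ c : ℝ, 0 < c ∧ w g (a' : Base g).1 = (c : ℂ) * w g (a : Base g).1) ∨ (∃ (k : Fin n) (b : ↥(beltPiece 3 2)), G.symm (D'.jA a') = D.jB k b ∧ G.symm (D'.jA a') ∉ range D.jA ∧ ∃ c : ℝ, 0 < c ∧ w g (a' : Base g).1 = (c : ℂ) * d k))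 ∧ (∀ (k' : Fin n) (b' : ↥(beltPiece 3 2)), D'.jB k' b' ∉ range D'.jA → G.symm (D'.jB k' b') ∈ (𝓡∂ 4).boundary X → (∃ a : ↥(coresComplement h), G.symm (D'.jB k' b') = D.jA a ∧ ∃ c : ℝ, 0 < c ∧ w g (a : Base g).1 = (c : ℂ) * Function.update d k₀ (d k₀ * Complex.exp ((ψ : ℂ) * Complex.I)) k') ∨ (∃ (k : Fin n) (b : ↥(beltPiece 3 2)), G.symm (D'.jB k' b') = D.jB k b ∧ G.symm (D'.jB k' b') ∉ range D.jA ∧ d k = Function.update d k₀ (d k₀ * Complex.exp ((ψ : ℂ) * Complex.I)) k')) := by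
  intro g n X₀ _ _ _ _ _ _ bX Ψ X _ _ _ _ _ _ G₀ h D d hd hpg hseam hbelt k₀ ψ R hψ0 hψ hRρ hRw hRcx hRflow
    hfree
  obtain ⟨h', D', hcirc, hothers, htw, hO1, hO2⟩ :=
    HCORE' g n X₀ bX Ψ X G₀ h D d hd hpg hseam hbelt k₀ ψ R hψ0 hψ hRρ hRw hRcx hRflow hfree
  obtain ⟨ε, L, L', y, y', a, a', hε, hLc, hL'c, hL, hLp, hy, ha, hrel, hy', ha'⟩ :=
    HSEAM g n X₀ bX Ψ X G₀ h D d hd hpg hseam hbelt k₀ ψ R hψ0 hψ hRρ hRw hRcx hRflow hfree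
  obtain ⟨R₃, τ₃, hiso⟩ :=
    HISO g n X₀ bX Ψ X G₀ h D d hd hpg hseam hbelt k₀ ψ R hψ0 hψ hRρ hRw hRcx hRflow hfree ε L L' y y'
      a a' hε hL hy ha hrel hy' ha'
  refine ⟨X, inferInstance, inferInstance, inferInstance, inferInstance, inferInstance, inferInstance,
    h', D', Diffeomorph.refl (𝓡∂ 4) X ∞, R, R₃, ε, τ₃, ε, L, L', y, y', a, a', hε, hLc, hL'c, hL, hLp,
    hy, ha, hrel, hy', ha', fun θ => ?_, fun θ => ?_, hothers, htw, fun a' ha' => hO1 a' ha',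
    fun k' b' hdeep hb => hO2 k' b' hdeep hb⟩
  · rw [hcirc θ, hiso θ]
  · rw [hcirc θ]
    refine ⟨(hRcx _ _).2 (hpg k₀ θ).1, ?_⟩
    rw [hRw, (hpg k₀ θ).2]
    ring

end Summit.SmoothPoincare4.SmoothPoincare4.Theorems.AcyclicBisectionExists.ModpBraidOrbits

end
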